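import Literature.MathematicalPhysics.QuantumFieldTheory.Balaban1983to89.B10Eq18SigmaSU2Window
import Literature.MathematicalPhysics.QuantumFieldTheory.Balaban1983to89.HaarExponentialChartMeasure

/-!
# `Balaban1983to89.B10Eq18SigmaSU2Chart` — T. Bałaban, *Ultraviolet stability of three-dimensional lattice pure gauge
# field theories*, Commun. Math. Phys. **102** (1985) 255–275 [Balaban1985UV3], p. 260: print's SU(2) example
# «σ(A) = 1/2π² (sin|A|/|A|)², σ₀ = σ(0), A = Σσ_aA^a» READ IN THE CELL'S GENERAL EXPONENTIAL CHART of
# [Helgason2000] Ch. I §1 Thm. 1.14 (13) (p28 `HaarExponentialChart`/`…Density`: chart `Θ`, window `V_s = Θ(B(0,s))`,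
# density `|det jac|`, chart measure `ν_s`) for `G = SU(2) ⊂ M₂(ℂ)` with `𝔤 = 𝔰𝔲(2)` in the Pauli coordinates —
# `Θ(iΣσ_aA^a) = exp iA`, `V_s = {exp iA : |A| < s}`, `|det jac(iΣσ_aA^a)| = σ(|A|)/σ₀`,
# `∫F dν_s = ∫_{|A|<s} F(exp iA)(σ/σ₀)(A) d³A`, and THE CONSTANT OF (13) EVALUATED:
# `dU|_{V_s} = (1/2π²)·ν_s`, `dU(V_s)/ν_s(V_s) = 1/2π² = σ₀`

statement-level skeleton of published theorems with citation tags; proofs where landed; nothing here is a claim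
about the Yang–Mills mass gap

PDF held: `paper:balaban1985-cmp102-uv-stability-3d`; p. 260 [PDF 6] re-read by this seat from the x2 render
`pub-balaban/b2b-balaban-ref1/pages/1985-cmp102-uv-stability-3d/1985-cmp102-uv-stability-3d-p006-x2.png` (2026-08-22).

THE PRINTED TEXT.  p. 260: *"we express the Haar measure dU′ as dU′ = σ(A′)dA′ = σ₀ σ/σ₀ (A′)dA′, σ₀ = σ(0), where
dA′ is the Lebesque measure on 𝔤 … For example for SU(2) we have σ(A) = 1/2π² (sin|A|/|A|)², where |A| = Σ_{a=1}^{3}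
(A^a)² ⟦sic⟧, and an element A of the Lie algebra is represented as A = Σ_{a=1}^{3} σ_aA^a"*; (18) restricts each bond
variable to the window *"χ({|A(b)| < g₀p²(g₀)})"*.

WHAT IS REPRODUCED.  Mega-formalization `lit-balaban` (HOME `run/shared/lean/pub/lit-balaban/`), unit `lit-balaban-r07`
gen 19.  SKELETON rows: narrative display E18 of `lit-balaban-r07/ROWS-B10.md` §2, row of record **B10.Eq21**.  State of
the tree: the cell's general measure-level Thm. 1.14 (13) programme (p28 `HaarLocalChart` p320990,
`HaarExponentialChart` p321835 = the chart `Θ = IsChartRep.expChart`, the window `V_s = IsChartRep.window`,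
`HaarExponentialChartDensity` p322253 = `jacDensity = |det jac|` and the chart measure `ν_s = IsChartRep.chartMeasure`,
`HaarExponentialChartCocycle` p322638, `HaarExponentialChartMeasure` p323361 = `μ|_{V_s} = (μV_s/ν_sV_s)•ν_s`
for every Haar `μ` of a compact `G` faithfully represented onto a log-charted linear group, `SU(N)` included) leaves
the constant `μ(V_s)/ν_s(V_s)` unevaluated («the constant σ₀ of a given Haar measure is not evaluated (for SU(2): 1/2π²,
r07's B10Eq18SigmaSU2Haar)», HONEST SCOPE (iii) of p322253); p24's `HaarExpChartClosedSubgroup` p322107 has it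
EXISTENTIAL.  This seat's `B10Eq18SigmaSU2Haar` (p319434/p320389/p320973) and `B10Eq18SigmaSU2Window` (p322968) give, on
the carrier `Matrix.specialUnitaryGroup (Fin 2) ℂ` with `haarProbability` and Pauli coordinates `EuclideanSpace ℝ (Fin 3)`,
`∫_{window} F dU = σ₀ ∫_{|A|<s} F(exp iA)(σ/σ₀)(A) d³A`, the window mass in closed form and `σ₀ = 1/2π²` as the window
ratio.  THIS FILE reads print's example IN THE GENERAL FRAMEWORK'S OWN OBJECTS, for the chart
`C = specialUnitaryLogChart (Fin 2)` (`𝔤 = C.lie = {X : X* = −X, tr X = 0} = 𝔰𝔲(2)`) and the representation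
`ρ = fundamentalRep (Fin 2)` (the inclusion `SU(2) ↪ M₂(ℂ)`):
* §1 the Pauli coordinates `A ↦ iΣσ_aA^a` land in `C.lie`, bijectively and ISOMETRICALLY for the chart's operator norm
  (`su2Coord_mem_lie`, `exists_su2Coord_eq_of_mem_lie`, `norm_pauli`; from `B10Eq18SigmaSU2Window.norm_su2Coord`), so
  the chart ball `B(0,s) ⊆ 𝔤` is the image of print's ball `{|A| < s}` (`ball_lie_eq_image`);
* §2 with p28's chart-representation witness `isChartRep_specialUnitaryGroup (n := Fin 2)` and `ad`-stability
  `lie_adStable_specialUnitaryGroup (n := Fin 2)` BY NAME (`HaarExponentialChartMeasure` p323361), the chart is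
  print's: **`Θ(iΣσ_aA^a) = exp iA`** (`expChart_pauli` = `B10Eq18SigmaSU2Haar.expPauli`), **the window is print's:
  `V_s = {exp iA : |A| < s}`** (`window_eq_image_expPauli`); the chart radius of `C` is `log(4/3) < π`
  (`chartRadius_su2`, `chartRadius_su2_lt_pi`); every statement is proved for an ARBITRARY witness
  `h : IsChartRep C ρ` (all equal, `IsChartRep` being a proposition);
* §3 **THE DENSITY IS PRINT'S `σ/σ₀`: `det jac(iΣσ_aA^a) = σ_{SU(2)}(|A|)/σ₀ = (sin|A|/|A|)²`** for the framework's
  `jac` on `C.lie` (`det_jac_pauli`, `jacDensity_pauli`; through r10's `B13HaarSigmaJacobian.det_jac_real_eq_sigmaRel`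
  in a Pauli basis of `C.lie`, the matrix of `ad` there being `−2[A]_×` (`toMatrix_adg_pauli`), and this seat's
  `B10Eq18SigmaSU2.sigmaRel_su2` / `B10Eq18SigmaSU2Haar.sigmaSU2_ratio_eq_sigmaRel` — r10's `det_jac_su2` is the same
  identity on the carrier `(su (Fin 2)).toSubmodule`);
* §4 with `η :=` Lebesgue measure `d³A` transported to `C.lie` by the Pauli coordinates: **`∫F dν_s = ∫_{|A|<s} F(exp iA)
  (σ/σ₀)(A) d³A`** (`lintegral_chartMeasure_pauli`), `ν_s(V_s) = 2π(s − sin s cos s)` (`chartMeasure_window_pauli`), and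
  **THE CONSTANT OF THM. 1.14 (13) EVALUATED AT PRINT'S EXAMPLE: `dU|_{V_s} = (1/2π²) • ν_s`**
  (`haarProbability_restrict_window_eq_smul_chartMeasure`, `0 < s ≤ log(4/3)`), `dU(V_s)/ν_s(V_s) = 1/2π²`
  (`haarProbability_window_div_chartMeasure_window`), the lintegral form
  `∫_{V_s} F dU = (1/2π²) ∫_{‖X‖<s} F(Θ X) |det jac X| dη(X)` (`setLIntegral_haarProbability_window_chart`) — i.e. in
  the general theorem's conclusion `μ|_{V_s} = (μV_s/ν_sV_s)•ν_s` the ratio IS print's `σ₀ = σ(0) = 1/2π²` for `G = SU(2)`,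
  `μ =` normalised Haar measure, `dA′ =` Lebesgue measure in the coordinates `A^a`: **the normalising constant of p28's
  `lintegral_haar_specialUnitaryGroup_window_eq` at `N = 2`, `μ(V_s)/∫_{B(0,s)}|det jac| dη`, EQUALS `1/2π²`**
  (`haarProbability_window_div_lintegral_jacDensity`), and that theorem, consumed BY NAME, then reads
  `∫_{V_s} F dU = (1/2π²) ∫ F(Θ X)|det jac X| dη` (`lintegral_haar_specialUnitaryGroup_two_window_eq` — the same
  identity as `setLIntegral_haarProbability_window_chart`, reached through p28's general theorem instead of this
  seat's SU(2) files: the two routes agree).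

HONEST SCOPE.  (i) Everything about Haar measure on `SU(2)` comes BY NAME from `B10Eq18SigmaSU2Haar`/`…Window`
(ultimately pub-balaban's `T4HaarSU2ExpChart`); everything about the general chart BY NAME from p28's
`HaarExponentialChart`/`HaarExponentialChartDensity`; the only computations here are the Pauli-basis matrix of `ad` on
`C.lie` and measure transport along the Pauli isometry.  (ii) `SU(2)` only; `N ≥ 3` has no closed-form density in the
tree.  (iii) The window radius is the framework's (`s ≤ log(4/3)`), smaller than print's injectivity radius `π`.
(iv) p28's `HaarExponentialChartMeasure` is imported for the names `isChartRep_specialUnitaryGroup`,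
`lie_adStable_specialUnitaryGroup`, `lintegral_haar_specialUnitaryGroup_window_eq` only; nothing of it is re-proved.
0 definitions, 0 new named facts.
-/

noncomputable section

open MeasureTheory MeasureTheory.Measure Set Metric NormedSpace
open scoped ENNReal Matrix.Norms.L2Operator

namespace Literature.MathematicalPhysics.QuantumFieldTheory.Balaban1983to89.B10Eq18SigmaSU2Chart

open Literature.MathematicalPhysics.QuantumLattice (fundamentalRep fundamentalRep_apply)
open Literature.MathematicalPhysics.QuantumFieldTheory (haarProbability)
open B10Eq18SigmaSU2 B10Eq22Rescaling B10Eq18SigmaSU2Haar B10Eq18SigmaSU2Window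
open HaarExponentialChart HaarExponentialChart.IsChartRep
open B13HaarSigmaJacobian (jac adg adg_apply_coe det_jac_real_eq_sigmaRel)
open B13HaarSigma (sigmaRel)

/-! ## §1  The Pauli coordinates `A ↦ iΣσ_aA^a` as an isometric parametrisation of `C.lie = 𝔰𝔲(2)` -/

section Coordinates

/-- `iΣσ_aA^a ∈ 𝔰𝔲(2) = C.lie` (skew-Hermitian, traceless). [cite: Balaban1985UV3, p. 260] -/
theorem su2Coord_mem_lie (x : Fin 3 → ℝ) : su2Coord x ∈ (specialUnitaryLogChart (Fin 2)).lie := by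
  rw [mem_specialUnitaryLogChart_lie, Matrix.star_eq_conjTranspose]
  exact Literature.Algebra.Lie.CompactKillingForm.mem_su_iff.1 (su2Coord_mem_su x)

/-- Every `X ∈ C.lie` is `iΣσ_aA^a` for a unique `A` (surjectivity; injectivity is `su2Coord_injective`).
[cite: Balaban1985UV3, p. 260] -/
theorem exists_su2Coord_eq_of_mem_lie {X : Matrix (Fin 2) (Fin 2) ℂ} (hX : X ∈ (specialUnitaryLogChart (Fin 2)).lie) :
    ∃ x : Fin 3 → ℝ, su2Coord x = X := by
  rw [mem_specialUnitaryLogChart_lie, Matrix.star_eq_conjTranspose] at hX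
  exact exists_su2Coord_eq (Literature.Algebra.Lie.CompactKillingForm.mem_su_iff.2 hX)

/-- `A ↦ iΣσ_aA^a` is additive. [cite: Balaban1985UV3, p. 260] -/
theorem su2Coord_add (x y : Fin 3 → ℝ) : su2Coord (x + y) = su2Coord x + su2Coord y := by
  simp only [su2Coord_eq_sum, Pi.add_apply, Complex.ofReal_add, add_mul, add_smul, Finset.sum_add_distrib]

/-- `A ↦ iΣσ_aA^a` is homogeneous. [cite: Balaban1985UV3, p. 260] -/
theorem su2Coord_smul (c : ℝ) (x : Fin 3 → ℝ) : su2Coord (c • x) = c • su2Coord x := by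
  rw [su2Coord_eq_sum, su2Coord_eq_sum, Finset.smul_sum]
  refine Finset.sum_congr rfl fun a _ => ?_
  rw [← smul_assoc, Complex.real_smul, Pi.smul_apply, smul_eq_mul, Complex.ofReal_mul, mul_assoc]

/-- `iΣσ_a·0 = 0`. [cite: Balaban1985UV3, p. 260] -/
theorem su2Coord_zero : su2Coord (0 : Fin 3 → ℝ) = 0 := by
  have h := su2Coord_smul 0 0
  rwa [zero_smul, zero_smul] at h

/-- **The Pauli coordinates are an isometry into `C.lie`** for the chart's (operator) norm: `‖⟨iΣσ_aA^a⟩‖ = |A|`.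
[cite: Balaban1985UV3, p. 260] -/
theorem norm_pauli (A : EuclideanSpace ℝ (Fin 3)) :
    ‖(⟨su2Coord A, su2Coord_mem_lie A⟩ : (specialUnitaryLogChart (Fin 2)).lie)‖ = ‖A‖ := by
  rw [← norm_su2Coord A]
  rfl

/-- `A ↦ ⟨iΣσ_aA^a⟩ ∈ C.lie` is continuous. [cite: Balaban1985UV3, p. 260] -/
theorem continuous_pauli :
    Continuous fun A : EuclideanSpace ℝ (Fin 3) => (⟨su2Coord A, su2Coord_mem_lie A⟩ : (specialUnitaryLogChart (Fin 2)).lie) := by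
  refine Continuous.subtype_mk ?_ _
  refine (LipschitzWith.of_dist_le_mul (K := 1) fun A B => ?_).continuous
  rw [dist_eq_norm, dist_eq_norm, norm_su2Coord_sub, NNReal.coe_one, one_mul]

/-- **The chart ball is print's ball**: `B(0, s) ⊆ C.lie` is the image of `{|A| < s}` under the Pauli coordinates.
[cite: Balaban1985UV3, (18) p. 260] -/
theorem ball_lie_eq_image (s : ℝ) :
    ball (0 : (specialUnitaryLogChart (Fin 2)).lie) s =
      (fun A : EuclideanSpace ℝ (Fin 3) => (⟨su2Coord A, su2Coord_mem_lie A⟩ : (specialUnitaryLogChart (Fin 2)).lie)) ''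
        ball (0 : EuclideanSpace ℝ (Fin 3)) s := by
  ext X
  constructor
  · intro hX
    obtain ⟨x, hx⟩ := exists_su2Coord_eq_of_mem_lie X.2
    refine ⟨WithLp.toLp 2 x, ?_, Subtype.ext hx⟩
    rw [mem_ball_zero_iff] at hX ⊢
    have hn := norm_pauli (WithLp.toLp 2 x)
    have hX' : (⟨su2Coord (WithLp.toLp 2 x), su2Coord_mem_lie _⟩ : (specialUnitaryLogChart (Fin 2)).lie) = X := Subtype.ext hx
    rw [hX'] at hn
    rw [← hn]
    exact hX
  · rintro ⟨A, hA, rfl⟩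
    rw [mem_ball_zero_iff] at hA ⊢
    rw [norm_pauli]
    exact hA

/-- The preimage form: `(Pauli)⁻¹(B(0,s)) = {|A| < s}`. [cite: Balaban1985UV3, (18) p. 260] -/
theorem preimage_pauli_ball (s : ℝ) :
    (fun A : EuclideanSpace ℝ (Fin 3) => (⟨su2Coord A, su2Coord_mem_lie A⟩ : (specialUnitaryLogChart (Fin 2)).lie)) ⁻¹' ball (0 : (specialUnitaryLogChart (Fin 2)).lie) s =
      ball (0 : EuclideanSpace ℝ (Fin 3)) s := by
  ext A
  rw [mem_preimage, mem_ball_zero_iff, mem_ball_zero_iff, norm_pauli]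

end Coordinates

-- Notational convention of the docstrings below: `C := specialUnitaryLogChart (Fin 2)` (so `C.lie = 𝔰𝔲(2)`),
-- `hlie := lie_adStable_specialUnitaryGroup (n := Fin 2)` (p28's `ad`-stability witness, BY NAME), and
-- `η := Measure.map (A ↦ ⟨iΣσ_aA^a⟩) volume` = Lebesgue measure `d³A` transported to `C.lie` by the Pauli coordinates
-- («dA′ is the Lebesque measure on 𝔤»).  They are written out in full in every statement (no notation is declared).

/-! ## §2  The chart representation of `SU(2)`, the chart `Θ(iA) = exp iA`, the window `V_s = {exp iA : |A| < s}` -/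

section Chart

variable (h : IsChartRep (specialUnitaryLogChart (Fin 2)) (fundamentalRep (Fin 2)))

/-- **THE CHART IS PRINT'S: `Θ(iΣσ_aA^a) = exp iA`** (`B10Eq18SigmaSU2Haar.expPauli`), for every chart-representation
witness `h`. [cite: Balaban1985UV3, p. 260] [cite: Helgason2000, Ch. I §1 Thm. 1.14 (13) p. 96] -/
theorem expChart_pauli (A : EuclideanSpace ℝ (Fin 3)) :
    h.expChart ⟨su2Coord A, su2Coord_mem_lie A⟩ = expPauli A := by
  apply h.injective
  rw [h.rho_expChart, fundamentalRep_apply, coe_expPauli]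

/-- As functions: `Θ ∘ Pauli = expPauli`. [cite: Balaban1985UV3, p. 260] -/
theorem expChart_comp_pauli :
    h.expChart ∘ (fun A : EuclideanSpace ℝ (Fin 3) => (⟨su2Coord A, su2Coord_mem_lie A⟩ : (specialUnitaryLogChart (Fin 2)).lie)) = expPauli :=
  funext (expChart_pauli h)

/-- **THE WINDOW IS PRINT'S: `V_s = Θ(B(0,s)) = {exp iA : |A| < s}`** — the set carrying the characteristic function
`χ({|A(b)| < s})` of (18), one bond. [cite: Balaban1985UV3, (18) p. 260] [cite: Helgason2000, Ch. I §1 Thm. 1.14 (13) p. 96] -/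
theorem window_eq_image_expPauli (s : ℝ) :
    h.window s = expPauli '' ball (0 : EuclideanSpace ℝ (Fin 3)) s := by
  rw [IsChartRep.window, ball_lie_eq_image, Set.image_image]
  exact congrArg (· '' _) (expChart_comp_pauli h)

/-- The inner radius of the `SU(2)` chart is `1/3` (`ρ = min(1/3, 3/2)`). [cite: Helgason2000, Ch. I §1 Thm. 1.14 (13) p. 96] -/
theorem innerRadius_su2 : innerRadius (specialUnitaryLogChart (Fin 2)) = 1 / 3 := by
  rw [innerRadius, specialUnitaryLogChart_ρ, Fintype.card_fin]
  norm_num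

/-- The chart radius of the `SU(2)` chart is `log(4/3)`. [cite: Helgason2000, Ch. I §1 Thm. 1.14 (13) p. 96] -/
theorem chartRadius_su2 : chartRadius (specialUnitaryLogChart (Fin 2)) = Real.log (4 / 3) := by
  rw [chartRadius, innerRadius_su2]
  norm_num

/-- The framework's window radii are inside print's injectivity radius: `chartRadius C < π`.
[cite: Balaban1985UV3, p. 260] -/
theorem chartRadius_su2_lt_pi : chartRadius (specialUnitaryLogChart (Fin 2)) < Real.pi := by
  have h1 := chartRadius_lt_log_two (C := specialUnitaryLogChart (Fin 2))
  have h2 : Real.log 2 < 1 := by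
    have := Real.log_two_lt_d9
    linarith
  linarith [Real.pi_gt_three]

/-- **The Haar mass of the framework's window in closed form**: `dU(V_s) = (s − sin s cos s)/π`, `0 ≤ s ≤ log(4/3)`
(`B10Eq18SigmaSU2Window.haarProbability_window_eq` read through `window_eq_image_expPauli`).
[cite: Balaban1985UV3, (18) p. 260] -/
theorem haarProbability_chartWindow_eq {s : ℝ} (hs0 : 0 ≤ s) (hs : s ≤ chartRadius (specialUnitaryLogChart (Fin 2))) :
    haarProbability (Matrix.specialUnitaryGroup (Fin 2) ℂ) (h.window s) =
      ENNReal.ofReal ((s - Real.sin s * Real.cos s) / Real.pi) := by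
  rw [window_eq_image_expPauli, haarProbability_window_eq hs0 (hs.trans chartRadius_su2_lt_pi.le)]

/-- … positive for `s > 0` and never the whole group (`< 1`): the framework's windows are proper.
[cite: Balaban1985UV3, (18) p. 260] -/
theorem haarProbability_chartWindow_pos_lt_one {s : ℝ} (hs0 : 0 < s) (hs : s ≤ chartRadius (specialUnitaryLogChart (Fin 2))) :
    0 < haarProbability (Matrix.specialUnitaryGroup (Fin 2) ℂ) (h.window s) ∧
      haarProbability (Matrix.specialUnitaryGroup (Fin 2) ℂ) (h.window s) < 1 := by
  rw [window_eq_image_expPauli]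
  exact ⟨haarProbability_window_pos hs0 (hs.trans chartRadius_su2_lt_pi.le),
    haarProbability_window_lt_one hs0.le (lt_of_le_of_lt hs chartRadius_su2_lt_pi)⟩

end Chart

/-! ## §3  The density is print's `σ/σ₀`: `det jac(iΣσ_aA^a) = σ_{SU(2)}(|A|)/σ₀ = (sin|A|/|A|)²` on `C.lie` -/

section Density

/-- **The matrix of `ad_𝔤(iΣσ_aA^a)` in the Pauli basis of `C.lie` is `−2[A]_×`** (the computation of r10's
`toMatrix_adg_su2`, on the carrier `C.lie`; `[A]_× = B10Eq18SigmaSU2.crossMatrix A`): for the basis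
`e_a = ⟨iσ_a⟩` of `C.lie` obtained from any linear equivalence `e : ℝ³ ≃ C.lie` with `e x = ⟨iΣσ_ax^a⟩`.
[cite: Balaban1985UV3, p. 260] [cite: Helgason2000, Ch. I §1 Thm. 1.14 (12) p. 96] -/
theorem toMatrix_adg_pauli (e : (Fin 3 → ℝ) ≃ₗ[ℝ] (specialUnitaryLogChart (Fin 2)).lie) (he : ∀ x, ((e x : (specialUnitaryLogChart (Fin 2)).lie) : Matrix (Fin 2) (Fin 2) ℂ) = su2Coord x)
    (A : Fin 3 → ℝ) :
    LinearMap.toMatrix ((Pi.basisFun ℝ (Fin 3)).map e) ((Pi.basisFun ℝ (Fin 3)).map e)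
        (adg (lie_adStable_specialUnitaryGroup (n := Fin 2)) (e A) : (specialUnitaryLogChart (Fin 2)).lie →ₗ[ℝ] (specialUnitaryLogChart (Fin 2)).lie) = (-2 : ℝ) • crossMatrix A := by
  ext i j
  rw [LinearMap.toMatrix_apply, Module.Basis.map_apply, Pi.basisFun_apply]
  have h1 : (adg (lie_adStable_specialUnitaryGroup (n := Fin 2)) (e A) : (specialUnitaryLogChart (Fin 2)).lie →ₗ[ℝ] (specialUnitaryLogChart (Fin 2)).lie) (e (Pi.single j 1)) =
      e ((-2 : ℝ) • (crossMatrix A).mulVec (Pi.single j 1)) := by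
    apply Subtype.ext
    rw [ContinuousLinearMap.coe_coe, adg_apply_coe, he, he, he, su2Coord_commutator]
  rw [h1, Module.Basis.map_repr, LinearEquiv.trans_apply, LinearEquiv.symm_apply_apply, Pi.basisFun_repr,
    Pi.smul_apply, Matrix.smul_apply, Matrix.mulVec, dotProduct]
  simp [Pi.single_apply]

/-- **THE DENSITY IS PRINT'S `σ/σ₀`**: for the framework's Jacobian endomorphism `jac` of the exponential chart on
`C.lie = 𝔰𝔲(2)` (r10's `B13HaarSigmaJacobian.jac`), `det jac(iΣσ_aA^a) = σ_{SU(2)}(|A|)/σ₀` — through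
`det_jac_real_eq_sigmaRel` in the Pauli basis (`= σrel(2[A]_× ⊗ ℂ)`) and `B10Eq18SigmaSU2Haar.sigmaSU2_ratio_eq_sigmaRel`.
[cite: Balaban1985UV3, p. 260] [cite: Helgason2000, Ch. I §1 Thm. 1.14 (12) p. 96] -/
theorem det_jac_pauli (A : EuclideanSpace ℝ (Fin 3)) :
    LinearMap.det (jac (lie_adStable_specialUnitaryGroup (n := Fin 2)) (⟨su2Coord A, su2Coord_mem_lie A⟩ : (specialUnitaryLogChart (Fin 2)).lie) : (specialUnitaryLogChart (Fin 2)).lie →ₗ[ℝ] (specialUnitaryLogChart (Fin 2)).lie) =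
      sigmaSU2 ‖A‖ / sigmaSU2 0 := by
  -- the Pauli linear equivalence `ℝ³ ≃ C.lie` and its basis
  let eₗ : (Fin 3 → ℝ) →ₗ[ℝ] (specialUnitaryLogChart (Fin 2)).lie :=
    { toFun := fun x => ⟨su2Coord x, su2Coord_mem_lie x⟩
      map_add' := fun x y => Subtype.ext (su2Coord_add x y)
      map_smul' := fun c x => Subtype.ext (su2Coord_smul c x) }
  have hinj : Function.Injective eₗ := fun x y hxy => su2Coord_injective (congrArg Subtype.val hxy)
  have hsurj : Function.Surjective eₗ := fun X => by
    obtain ⟨x, hx⟩ := exists_su2Coord_eq_of_mem_lie X.2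
    exact ⟨x, Subtype.ext hx⟩
  let e : (Fin 3 → ℝ) ≃ₗ[ℝ] (specialUnitaryLogChart (Fin 2)).lie := LinearEquiv.ofBijective eₗ ⟨hinj, hsurj⟩
  have he : ∀ x, ((e x : (specialUnitaryLogChart (Fin 2)).lie) : Matrix (Fin 2) (Fin 2) ℂ) = su2Coord x := fun x => rfl
  have hX : (⟨su2Coord A, su2Coord_mem_lie A⟩ : (specialUnitaryLogChart (Fin 2)).lie) = e (A : Fin 3 → ℝ) := rfl
  apply Complex.ofReal_injective
  have h1 := det_jac_real_eq_sigmaRel (lie_adStable_specialUnitaryGroup (n := Fin 2)) ((Pi.basisFun ℝ (Fin 3)).map e) (e (A : Fin 3 → ℝ))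
  rw [Complex.coe_algebraMap] at h1
  rw [hX, h1, ← map_neg, toMatrix_adg_pauli e he, crossMatrix_neg, smul_neg, ← neg_smul, neg_neg,
    sigmaSU2_ratio_eq_sigmaRel, Complex.coe_algebraMap]

/-- `det jac(iΣσ_aA^a) = sinc²|A|`. [cite: Balaban1985UV3, p. 260] [cite: Helgason2000, Ch. I §1 Thm. 1.14 (12) p. 96] -/
theorem det_jac_pauli_eq_sinc_sq (A : EuclideanSpace ℝ (Fin 3)) :
    LinearMap.det (jac (lie_adStable_specialUnitaryGroup (n := Fin 2)) (⟨su2Coord A, su2Coord_mem_lie A⟩ : (specialUnitaryLogChart (Fin 2)).lie) : (specialUnitaryLogChart (Fin 2)).lie →ₗ[ℝ] (specialUnitaryLogChart (Fin 2)).lie) =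
      Real.sinc ‖A‖ ^ 2 := by
  rw [det_jac_pauli, sigmaSU2_div_sigma0_eq_sinc_sq]

/-- `det jac ≥ 0` on all of `𝔰𝔲(2)` (no absolute value needed in (13) for SU(2)). [cite: Balaban1985UV3, p. 260] -/
theorem det_jac_pauli_nonneg (A : EuclideanSpace ℝ (Fin 3)) :
    0 ≤ LinearMap.det (jac (lie_adStable_specialUnitaryGroup (n := Fin 2)) (⟨su2Coord A, su2Coord_mem_lie A⟩ : (specialUnitaryLogChart (Fin 2)).lie) : (specialUnitaryLogChart (Fin 2)).lie →ₗ[ℝ] (specialUnitaryLogChart (Fin 2)).lie) := by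
  rw [det_jac_pauli]
  exact sigmaSU2_div_sigma0_nonneg A

/-- **The framework's density `jacDensity = |det jac|` at `iΣσ_aA^a` is print's `σ(|A|)/σ₀`** (as an `ℝ≥0∞` value).
[cite: Balaban1985UV3, p. 260] [cite: Helgason2000, Ch. I §1 Thm. 1.14 (12) p. 96] -/
theorem jacDensity_pauli (A : EuclideanSpace ℝ (Fin 3)) :
    jacDensity (lie_adStable_specialUnitaryGroup (n := Fin 2)) (⟨su2Coord A, su2Coord_mem_lie A⟩ : (specialUnitaryLogChart (Fin 2)).lie) = ENNReal.ofReal (sigmaSU2 ‖A‖ / sigmaSU2 0) := by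
  rw [jacDensity_def, det_jac_pauli, abs_of_nonneg (sigmaSU2_div_sigma0_nonneg A)]

end Density

/-! ## §4  The chart measure in Pauli coordinates and THE CONSTANT OF (13) EVALUATED: `dU|_{V_s} = (1/2π²)•ν_s` -/

section ChartMeasure

variable [MeasurableSpace (specialUnitaryLogChart (Fin 2)).lie] [BorelSpace (specialUnitaryLogChart (Fin 2)).lie]
variable (h : IsChartRep (specialUnitaryLogChart (Fin 2)) (fundamentalRep (Fin 2)))

/-- The Pauli coordinate map into `C.lie` is measurable. [cite: Balaban1985UV3, p. 260] -/
theorem measurable_pauli :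
    Measurable fun A : EuclideanSpace ℝ (Fin 3) => (⟨su2Coord A, su2Coord_mem_lie A⟩ : (specialUnitaryLogChart (Fin 2)).lie) :=
  continuous_pauli.measurable

/-- **`∫ F dν_s = ∫_{|A|<s} F(exp iA) (σ/σ₀)(A) d³A`**: the framework's chart measure `ν_s = Θ_*(|det jac| dη|_{B(0,s)})`,
with `η = d³A` transported to `C.lie` by the Pauli coordinates («dA′ is the Lebesque measure on 𝔤», coordinates `A^a`),
integrates exactly as print's `(σ/σ₀)(A′)dA′` on the window, pushed forward by `A ↦ exp iA`.
[cite: Balaban1985UV3, p. 260] [cite: Helgason2000, Ch. I §1 Thm. 1.14 (13) p. 96] -/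
theorem lintegral_chartMeasure_pauli (s : ℝ) {F : Matrix.specialUnitaryGroup (Fin 2) ℂ → ℝ≥0∞} (hF : Measurable F) :
    ∫⁻ g, F g ∂(h.chartMeasure (lie_adStable_specialUnitaryGroup (n := Fin 2)) (Measure.map (fun A : EuclideanSpace ℝ (Fin 3) =>
          (⟨su2Coord A, su2Coord_mem_lie A⟩ : (specialUnitaryLogChart (Fin 2)).lie)) volume) s) =
      ∫⁻ A in ball (0 : EuclideanSpace ℝ (Fin 3)) s, F (expPauli A) * ENNReal.ofReal (sigmaSU2 ‖A‖ / sigmaSU2 0) := by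
  have hmeas : Measurable fun X : (specialUnitaryLogChart (Fin 2)).lie => F (h.expChart X) * jacDensity (lie_adStable_specialUnitaryGroup (n := Fin 2)) X :=
    (hF.comp h.measurable_expChart).mul (measurable_jacDensity (lie_adStable_specialUnitaryGroup (n := Fin 2)))
  rw [h.lintegral_chartMeasure (lie_adStable_specialUnitaryGroup (n := Fin 2)) _ s hF, setLIntegral_map measurableSet_ball hmeas measurable_pauli,
    preimage_pauli_ball]
  refine setLIntegral_congr_fun measurableSet_ball fun A _ => ?_
  rw [expChart_pauli, jacDensity_pauli]

/-- **`ν_s(V_s) = ∫_{|A|<s} (σ/σ₀) d³A = 2π(s − sin s cos s)`** for `0 ≤ s ≤ log(4/3)`.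
[cite: Balaban1985UV3, p. 260] [cite: Helgason2000, Ch. I §1 Thm. 1.14 (13) p. 96] -/
theorem chartMeasure_window_pauli {s : ℝ} (hs0 : 0 ≤ s) (hs : s ≤ chartRadius (specialUnitaryLogChart (Fin 2))) :
    h.chartMeasure (lie_adStable_specialUnitaryGroup (n := Fin 2)) (Measure.map (fun A : EuclideanSpace ℝ (Fin 3) =>
          (⟨su2Coord A, su2Coord_mem_lie A⟩ : (specialUnitaryLogChart (Fin 2)).lie)) volume) s (h.window s) = ENNReal.ofReal (2 * Real.pi * (s - Real.sin s * Real.cos s)) := by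
  rw [h.chartMeasure_window (lie_adStable_specialUnitaryGroup (n := Fin 2)) _ hs,
    setLIntegral_map measurableSet_ball (measurable_jacDensity (lie_adStable_specialUnitaryGroup (n := Fin 2))) measurable_pauli, preimage_pauli_ball,
    ← lintegral_sigmaRatio_ball_eq hs0]
  exact setLIntegral_congr_fun measurableSet_ball fun A _ => jacDensity_pauli A

/-- **THEOREM 1.14 (13) FOR PRINT'S EXAMPLE WITH THE CONSTANT EVALUATED: `dU|_{V_s} = (1/2π²) • ν_s`** — normalised
Haar measure of `SU(2)` restricted to the chart window `V_s = {exp iA : |A| < s}` (`0 < s ≤ log(4/3)`) is `σ₀ = 1/2π²`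
times the chart measure `ν_s = Θ_*(|det jac| d³A|_{B(0,s)})`; in the general statement `μ|_{V_s} = (μV_s/ν_sV_s)•ν_s`
of the cell's measure-level (13) the ratio is therefore print's `σ₀ = σ(0)`.
[cite: Balaban1985UV3, p. 260] [cite: Helgason2000, Ch. I §1 Thm. 1.14 (13) p. 96] -/
theorem haarProbability_restrict_window_eq_smul_chartMeasure {s : ℝ} (hs : s ≤ chartRadius (specialUnitaryLogChart (Fin 2))) :
    (haarProbability (Matrix.specialUnitaryGroup (Fin 2) ℂ)).restrict (h.window s) =
      ENNReal.ofReal (1 / (2 * Real.pi ^ 2)) •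
        h.chartMeasure (lie_adStable_specialUnitaryGroup (n := Fin 2)) (Measure.map (fun A : EuclideanSpace ℝ (Fin 3) =>
          (⟨su2Coord A, su2Coord_mem_lie A⟩ : (specialUnitaryLogChart (Fin 2)).lie)) volume) s := by
  have hsπ : s ≤ Real.pi := hs.trans chartRadius_su2_lt_pi.le
  refine Measure.ext_of_lintegral _ fun F hF => ?_
  rw [window_eq_image_expPauli, setLIntegral_haarProbability_window_ratio hsπ F hF, lintegral_smul_measure,
    lintegral_chartMeasure_pauli h s hF, sigmaSU2_zero, smul_eq_mul]

/-- **The ratio of the general theorem IS `σ₀`: `dU(V_s) / ν_s(V_s) = 1/2π²`** for `0 < s ≤ log(4/3)`.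
[cite: Balaban1985UV3, p. 260] [cite: Helgason2000, Ch. I §1 Thm. 1.14 (13) p. 96] -/
theorem haarProbability_window_div_chartMeasure_window {s : ℝ} (hs0 : 0 < s) (hs : s ≤ chartRadius (specialUnitaryLogChart (Fin 2))) :
    haarProbability (Matrix.specialUnitaryGroup (Fin 2) ℂ) (h.window s) /
        h.chartMeasure (lie_adStable_specialUnitaryGroup (n := Fin 2)) (Measure.map (fun A : EuclideanSpace ℝ (Fin 3) =>
          (⟨su2Coord A, su2Coord_mem_lie A⟩ : (specialUnitaryLogChart (Fin 2)).lie)) volume) s (h.window s) = ENNReal.ofReal (1 / (2 * Real.pi ^ 2)) := by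
  have hsπ : s ≤ Real.pi := hs.trans chartRadius_su2_lt_pi.le
  rw [chartMeasure_window_pauli h hs0.le hs, ← lintegral_sigmaRatio_ball_eq hs0.le, window_eq_image_expPauli,
    ← sigmaSU2_zero, ofReal_sigma0_eq_window_ratio hs0 hsπ]

/-- **The lintegral form of (13) at print's example, constant evaluated**: for measurable `F ≥ 0` and `0 < s ≤ log(4/3)`,
`∫_{V_s} F dU = (1/2π²) ∫_{‖X‖<s} F(Θ X) |det jac X| dη(X)`, `η` = Lebesgue measure in the Pauli coordinates.
[cite: Balaban1985UV3, p. 260] [cite: Helgason2000, Ch. I §1 Thm. 1.14 (13) p. 96] -/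
theorem setLIntegral_haarProbability_window_chart {s : ℝ} (hs : s ≤ chartRadius (specialUnitaryLogChart (Fin 2)))
    {F : Matrix.specialUnitaryGroup (Fin 2) ℂ → ℝ≥0∞} (hF : Measurable F) :
    ∫⁻ g in h.window s, F g ∂(haarProbability (Matrix.specialUnitaryGroup (Fin 2) ℂ)) =
      ENNReal.ofReal (1 / (2 * Real.pi ^ 2)) *
        ∫⁻ X in ball (0 : (specialUnitaryLogChart (Fin 2)).lie) s, F (h.expChart X) * jacDensity (lie_adStable_specialUnitaryGroup (n := Fin 2)) X ∂(Measure.map (fun A : EuclideanSpace ℝ (Fin 3) =>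
          (⟨su2Coord A, su2Coord_mem_lie A⟩ : (specialUnitaryLogChart (Fin 2)).lie)) volume) := by
  rw [haarProbability_restrict_window_eq_smul_chartMeasure h hs, lintegral_smul_measure, smul_eq_mul,
    h.lintegral_chartMeasure (lie_adStable_specialUnitaryGroup (n := Fin 2)) _ s hF]

/-- `∫_{B(0,s)} |det jac| dη = ∫_{|A|<s} (σ/σ₀) d³A = 2π(s − sin s cos s)` — the denominator of the general theorem's
constant, in Pauli coordinates, `s ≥ 0`. [cite: Balaban1985UV3, p. 260] [cite: Helgason2000, Ch. I §1 Thm. 1.14 (13) p. 96] -/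
theorem lintegral_jacDensity_ball_pauli {s : ℝ} (hs0 : 0 ≤ s) :
    ∫⁻ X in ball (0 : (specialUnitaryLogChart (Fin 2)).lie) s, jacDensity (lie_adStable_specialUnitaryGroup (n := Fin 2)) X ∂(Measure.map (fun A : EuclideanSpace ℝ (Fin 3) =>
          (⟨su2Coord A, su2Coord_mem_lie A⟩ : (specialUnitaryLogChart (Fin 2)).lie)) volume) = ENNReal.ofReal (2 * Real.pi * (s - Real.sin s * Real.cos s)) := by
  rw [setLIntegral_map measurableSet_ball (measurable_jacDensity (lie_adStable_specialUnitaryGroup (n := Fin 2))) measurable_pauli, preimage_pauli_ball,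
    ← lintegral_sigmaRatio_ball_eq hs0]
  exact setLIntegral_congr_fun measurableSet_ball fun A _ => jacDensity_pauli A

/-- **THE NORMALISING CONSTANT OF p28's `lintegral_haar_specialUnitaryGroup_window_eq` AT `N = 2` IS PRINT'S `σ₀`:
`dU(V_s) / ∫_{B(0,s)} |det jac| dη = 1/2π²`** (`μ =` normalised Haar measure, `η = d³A` in Pauli coordinates,
`0 < s ≤ log(4/3)`). [cite: Balaban1985UV3, p. 260] [cite: Helgason2000, Ch. I §1 Thm. 1.14 (13) p. 96] -/
theorem haarProbability_window_div_lintegral_jacDensity {s : ℝ} (hs0 : 0 < s) (hs : s ≤ chartRadius (specialUnitaryLogChart (Fin 2))) :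
    haarProbability (Matrix.specialUnitaryGroup (Fin 2) ℂ) (h.window s) /
        ∫⁻ X in ball (0 : (specialUnitaryLogChart (Fin 2)).lie) s, jacDensity (lie_adStable_specialUnitaryGroup (n := Fin 2)) X ∂(Measure.map (fun A : EuclideanSpace ℝ (Fin 3) =>
          (⟨su2Coord A, su2Coord_mem_lie A⟩ : (specialUnitaryLogChart (Fin 2)).lie)) volume) = ENNReal.ofReal (1 / (2 * Real.pi ^ 2)) := by
  rw [← h.chartMeasure_window (lie_adStable_specialUnitaryGroup (n := Fin 2)) _ hs, haarProbability_window_div_chartMeasure_window h hs0 hs]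

/-- `η = d³A` in Pauli coordinates IS an additive Haar («Lebesgue») measure on `C.lie` (image of Lebesgue measure under a
linear homeomorphism `ℝ³ ≃ C.lie`). [cite: Balaban1985UV3, p. 260] -/
theorem isAddHaarMeasure_pauli : (Measure.map (fun A : EuclideanSpace ℝ (Fin 3) =>
          (⟨su2Coord A, su2Coord_mem_lie A⟩ : (specialUnitaryLogChart (Fin 2)).lie)) volume).IsAddHaarMeasure := by
  let eₗ : (Fin 3 → ℝ) →ₗ[ℝ] (specialUnitaryLogChart (Fin 2)).lie :=
    { toFun := fun x => ⟨su2Coord x, su2Coord_mem_lie x⟩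
      map_add' := fun x y => Subtype.ext (su2Coord_add x y)
      map_smul' := fun c x => Subtype.ext (su2Coord_smul c x) }
  have hinj : Function.Injective eₗ := fun x y hxy => su2Coord_injective (congrArg Subtype.val hxy)
  have hsurj : Function.Surjective eₗ := fun X => by
    obtain ⟨x, hx⟩ := exists_su2Coord_eq_of_mem_lie X.2
    exact ⟨x, Subtype.ext hx⟩
  let e : EuclideanSpace ℝ (Fin 3) ≃L[ℝ] (specialUnitaryLogChart (Fin 2)).lie :=
    ((WithLp.linearEquiv 2 ℝ (Fin 3 → ℝ)).trans (LinearEquiv.ofBijective eₗ ⟨hinj, hsurj⟩)).toContinuousLinearEquiv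
  have he : (fun A : EuclideanSpace ℝ (Fin 3) => (⟨su2Coord A, su2Coord_mem_lie A⟩ : (specialUnitaryLogChart (Fin 2)).lie)) = e := rfl
  rw [he]
  exact e.isAddHaarMeasure_map volume

/-- **p28's GENERAL THEOREM, CONSUMED BY NAME AT PRINT'S EXAMPLE**: `HaarExponentialChart.lintegral_haar_specialUnitaryGroup_window_eq`
at `N = 2`, `μ =` normalised Haar measure of `SU(2)`, `η = d³A` in Pauli coordinates, with its constant evaluated by
`haarProbability_window_div_lintegral_jacDensity`: `∫_{V_s} F dU = (1/2π²) ∫_{‖X‖<s} F(Θ X) |det jac X| dη(X)` for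
measurable `F ≥ 0`, `0 < s ≤ log(4/3)` — the same identity as `setLIntegral_haarProbability_window_chart`, reached
through the general measure-level (13) instead of this seat's SU(2) files (the two routes agree).
[cite: Balaban1985UV3, p. 260] [cite: Helgason2000, Ch. I §1 Thm. 1.14 (13) p. 96] -/
theorem lintegral_haar_specialUnitaryGroup_two_window_eq {s : ℝ} (hs0 : 0 < s) (hs : s ≤ chartRadius (specialUnitaryLogChart (Fin 2)))
    {F : Matrix.specialUnitaryGroup (Fin 2) ℂ → ℝ≥0∞} (hF : Measurable F) :
    ∫⁻ g in (isChartRep_specialUnitaryGroup (n := Fin 2)).window s, F g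
        ∂(haarProbability (Matrix.specialUnitaryGroup (Fin 2) ℂ)) =
      ENNReal.ofReal (1 / (2 * Real.pi ^ 2)) *
        ∫⁻ X in ball (0 : (specialUnitaryLogChart (Fin 2)).lie) s, F ((isChartRep_specialUnitaryGroup (n := Fin 2)).expChart X) * jacDensity (lie_adStable_specialUnitaryGroup (n := Fin 2)) X ∂(Measure.map (fun A : EuclideanSpace ℝ (Fin 3) =>
          (⟨su2Coord A, su2Coord_mem_lie A⟩ : (specialUnitaryLogChart (Fin 2)).lie)) volume) := by
  haveI : (Measure.map (fun A : EuclideanSpace ℝ (Fin 3) =>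
          (⟨su2Coord A, su2Coord_mem_lie A⟩ : (specialUnitaryLogChart (Fin 2)).lie)) volume).IsAddHaarMeasure := isAddHaarMeasure_pauli
  haveI : (haarProbability (Matrix.specialUnitaryGroup (Fin 2) ℂ)).IsHaarMeasure := Measure.isHaarMeasure_haarMeasure ⊤
  rw [lintegral_haar_specialUnitaryGroup_window_eq (n := Fin 2) (Measure.map (fun A : EuclideanSpace ℝ (Fin 3) =>
          (⟨su2Coord A, su2Coord_mem_lie A⟩ : (specialUnitaryLogChart (Fin 2)).lie)) volume) (haarProbability _) hs0 hs hF,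
    haarProbability_window_div_lintegral_jacDensity _ hs0 hs]

end ChartMeasure

end Literature.MathematicalPhysics.QuantumFieldTheory.Balaban1983to89.B10Eq18SigmaSU2Chart

end
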